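import Summits.MatrixMultiplication.MatrixMultiplication.Theses.SaturationLadder
import Mathlib.Analysis.SpecialFunctions.Log.NegMulLog
import HarnessLib

/-!
# `SaturationLadderThinFloor` — the universal-method barrier is blind along the thin axis
(support for crux stmt-MatrixMultiplication-25909 `SubexpSaturation` of route `SaturationLadder`;
decomposition cell `decomp-mm`, lens 1 «grading / quantitative ladder», generation 13)

Every certificate behind the ladder's proved rungs (`ExpSaturation`, `TwinSaturation`,
`SubThreeSaturation`, the family constant `θ_F = 2^{47/30}` of `SaturationLadderFamilyConstant`) is a
flattening-exact degeneration of a power of a big Coppersmith–Winograd tensor,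
`CW_q^{⊗N} ⊵ ⊕_K ⟨M, M^t, M^r⟩` with `K · M^{1+r} = (q+2)^{N(1-o(1))}` — exactness of the
`(1+r)`-flattening is what makes the resulting bound `ω(1,t,r) ≤ 1 + r` tight.  The
Christandl–Le Gall–Lysikov–Zuiddam barrier (tree: `Literature.Barriers.MatrixMultiplication.RectangularBarrier`,
`IsAdequate.barrier`, `IsAdequate.le_tMethodBound`; Alman–Vassilevska Williams for the square) says that
for every ADEQUATE functional `F` such a degeneration forces `F(CW_q)^N ≥ K · F(⟨M,M^t,M^r⟩)`.  Over `ℂ`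
every adequate functional anyone can write down is a quantum functional `F^θ` (= every known universal
spectral point, tree `IsUniversalSpectralPoint.isAdequate`; lens-1 g12 note B-SPECTRAL-BRIGHT) or an
upper support functional `ζ^θ` (tree `CLLZ2025_lem42`), and on the FREE tensor `CW_q` (standard support
`{(0,i,i),(i,0,i),(i,i,0) : 1 ≤ i ≤ q} ∪ {(0,0,q+1),(0,q+1,0),(q+1,0,0)}`: any two points differ in at
least two coordinates) the two coincide and equal the support maximum
`log₂ F^θ(CW_q) = log₂ ζ^θ(CW_q) = max_P Σ_j θ_j H(P_j)` over probability laws `P` on that support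
[cite: ChristandlVranaZuiddam2023, Def. 4.17 and Thm. 4.20 (arXiv 1709.07851 numbering; proof: the ordered
marginals of every law on a free support lie in the entanglement polytope)] (tree: `maxWeightedEntropy`,
`logUpperSupportFunctional`).  With `F^θ(⟨a,b,c⟩) = (ab)^{θ₁}(bc)^{θ₂}(ca)^{θ₃}`
[cite: ChristandlLeGallLysikovZuiddam2025, Lemma 4.1] the barrier inequality for an exact thin
certificate reads, after eliminating `M` (write `K = (q+2)^{κN}`, `M^{1+r} = (q+2)^{(1−κ)N}`),
`max_P Σ_j θ_j H(P_j) ≥ (1 − (1−κ)[θ₁(r−t) + θ₂(1−t)]/(1+r)) · log(q+2)`; the right side increases with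
`κ`, so the least constrained accounting is a single product, `κ = 0`, and the barrier excludes the
length `r` at `t` iff it excludes it for `κ = 0`:

  `(E)   max_P Σ_j θ_j H(P_j) ≥ (1 − [θ₁(r−t) + θ₂(1−t)]/(1+r)) · log(q+2)   for every θ ∈ Δ₂`,

and by Sion's minimax theorem (the left side is a maximum of functions linear in `θ`, the right side is
linear in `θ`) `(E)` holds for all `θ` iff ONE law `P` satisfies the three vertex inequalities
`H_z(P) ≥ log(q+2)`, `H_y(P) ≥ (t+r)/(1+r) · log(q+2)`, `H_x(P) ≥ (1+t)/(1+r) · log(q+2)` (memo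
`thin-axis-barrier-floor-g13.md` §2; at `r = 1` this criterion is exactly the CLLZ `α`-barrier and
reproduces the tree's replication of CLLZ Table 3 — `q = 2`: `t* = 0.6225…` vs `3 − (3/2)log₂3 = 0.62256`).

THIS FILE proves, with no definitions and no named facts, that the explicit law

  `P_δ = (1/(q+2) − δ)·Σ_i [(0,i,i)] + δ·Σ_i [(i,0,i)] + (1/(q+2))·[(0,0,q+1)] + (1/(q+2))·[(0,q+1,0)]`,
  `δ = 1/((q+2)(1+r))`,

whose marginal laws are `P_x = (1 − qδ ; δ ×q ; 0)`, `P_y = (1/(q+2) + qδ ; (1/(q+2) − δ) ×q ; 1/(q+2))`,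
`P_z = uniform on q+2 symbols` (entropies in nats, `H = Σ negMulLog`), satisfies the three vertex
inequalities — hence `(E)` for every `θ` (`thinFloor_allTheta`, `thinFloor_barrier_le`) — as soon as

  `(q+2)³ ≤ 1 + r`   and   `q + 2 ≤ (1 − t)(1 + r) log(q+2)`.

CONSEQUENCE (the point of the file).  For every fixed `q ≥ 2` no known adequate functional excludes a
flattening-exact thin certificate from `CW_q` at ANY `t < 1` once the length is LINEAR in `1/(1−t)`:
`r ≥ max((q+2)³, (q+2)/((1−t) log(q+2))) − 1` (e.g. `q = 2`: `r ≥ max(63, 2.89/(1−t))`).  The exact floor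
is even `Θ_q(1/((1−t) log²(1/(1−t))))` (memo §3, table: `q = 2`: `r ≥ 3.4, 18.5, 103` at
`t = 0.9, 0.99, 0.999`), while every certificate in print or in the tree has `r ≥ θ_F^{1/(1−t)}`,
`θ_F = 2.9622` (`10^{47}` at `t = 0.99`).  So the universal-method barrier, which at `r = 1` caps the
certifiable dual exponent at `0.6226` against the known `α ≥ 0.3213`, is exponentially slack along the
thin axis: the crux `SubexpSaturation` (⟺ `⋀_{θ>1} Base θ`, `SaturationLadderBaseFamily`), its rate lift
`SubexpToPoly` (stmt-25910), `PolySaturation` (stmt-25915) and even linear saturation all lie in the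
barrier's blind region FOR A SINGLE FIXED `CW_q`.  Closing the crux inside the class «degenerations of
`CW_q` powers» therefore does not require beating a catalogued barrier (BC8 placement: inside the class,
not excluded); what it requires is a flattening-exact degeneration that is not a block-product (laser)
design, whose reach is `exp((1.06…1.39)/(1−t))` (notes B-LVL1, B-THIN-FLOOR of the lens).

References: Christandl–Vrana–Zuiddam, *Universal points in the asymptotic spectrum of tensors*, JAMS 36
(2023) / STOC 2018 / arXiv 1709.07851, Def. 4.17, Thm. 4.20, Ex. 4.22 [ChristandlVranaZuiddam2023]; Christandl–Le Gall–Lysikov–Zuiddam,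
comput. complexity 34 (2025), Thm. 3.15, Thm. 3.22, Lemma 4.1–4.2, §4.3–4.4 [ChristandlLeGallLysikovZuiddam2025];
Alman–Vassilevska Williams, *Limits on all known (and some unknown) approaches to matrix multiplication*,
FOCS 2018 [AlmanVassilevskaWilliams2018]; Coppersmith–Winograd 1990 §6–8 [CoppersmithWinograd1990].
No new definitions, no named facts, no sorry.
-/

set_option linter.dupNamespace false
-- (single-conjunct summit: the namespace repeats `MatrixMultiplication`)

noncomputable section

namespace Summit.MatrixMultiplication.MatrixMultiplication.Theorems.SaturationLadderThinFloor

open Real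

/-! ## Part A — the three marginal entropies of `P_δ` -/

/-- x-marginal of `P_δ`: the law `(1 − qδ ; δ, …, δ (q times))` has entropy
`negMulLog(1 − qδ) + q·negMulLog δ ≥ qδ·log(1/δ)` (the first summand is `≥ 0` on `[0,1]`).
[cite: ChristandlVranaZuiddam2023, Thm. 4.20] -/
theorem hx_lower (q : ℕ) {δ : ℝ} (hδ : 0 ≤ δ) (hqδ : (q : ℝ) * δ ≤ 1) :
    (q : ℝ) * δ * Real.log (1 / δ) ≤ negMulLog (1 - q * δ) + q * negMulLog δ := by
  have hq0 : (0 : ℝ) ≤ q := Nat.cast_nonneg q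
  have h1 : 0 ≤ negMulLog (1 - (q : ℝ) * δ) :=
    negMulLog_nonneg (by linarith) (by nlinarith [mul_nonneg hq0 hδ])
  have h2 : (q : ℝ) * δ * Real.log (1 / δ) = q * negMulLog δ := by
    show (q : ℝ) * δ * Real.log (1 / δ) = q * (-δ * Real.log δ)
    rw [one_div, Real.log_inv]
    ring
  linarith [h1, h2]

/-- y-marginal of `P_δ`: the law `(1/(q+2) + qδ ; 1/(q+2) − δ (q times) ; 1/(q+2))` has entropy at
least `log(q+2) − q(q+1)(q+2)δ²` (from `log(1+u) ≤ u`, `log(1−v) ≤ −v`; the exact second-order loss is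
half of that). [cite: ChristandlVranaZuiddam2023, Thm. 4.20] -/
theorem hy_lower (q : ℕ) {δ : ℝ} (hδ : 0 ≤ δ) (hδ' : ((q : ℝ) + 2) * δ < 1) :
    Real.log ((q : ℝ) + 2) - q * (q + 1) * (q + 2) * δ ^ 2 ≤
      negMulLog (1 / ((q : ℝ) + 2) + q * δ) + q * negMulLog (1 / ((q : ℝ) + 2) - δ)
        + negMulLog (1 / ((q : ℝ) + 2)) := by
  set L := Real.log ((q : ℝ) + 2) with hL
  have hq2 : (0 : ℝ) < (q : ℝ) + 2 := by positivity
  have hq2' : (q : ℝ) + 2 ≠ 0 := ne_of_gt hq2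
  have hq0 : (0 : ℝ) ≤ q := Nat.cast_nonneg q
  have hm0 : 0 < 1 / ((q : ℝ) + 2) + q * δ := by positivity
  have hmi : 0 ≤ 1 / ((q : ℝ) + 2) - δ := by
    rw [sub_nonneg, le_div_iff₀ hq2]
    linarith
  -- first-order logarithm bounds
  have hlog0 : Real.log (1 / ((q : ℝ) + 2) + q * δ) ≤ q * (q + 2) * δ - L := by
    have e : 1 / ((q : ℝ) + 2) + q * δ = (1 + q * (q + 2) * δ) / (q + 2) := by
      field_simp
    rw [e, Real.log_div (by positivity) hq2']
    have := Real.log_le_sub_one_of_pos (show (0 : ℝ) < 1 + q * (q + 2) * δ by positivity)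
    linarith
  have hlogi : Real.log (1 / ((q : ℝ) + 2) - δ) ≤ -((q + 2) * δ) - L := by
    have e : 1 / ((q : ℝ) + 2) - δ = (1 - (q + 2) * δ) / (q + 2) := by
      field_simp
    rw [e, Real.log_div (by linarith) hq2']
    have := Real.log_le_sub_one_of_pos (show (0 : ℝ) < 1 - (q + 2) * δ by linarith)
    linarith
  have hlog2 : Real.log (1 / ((q : ℝ) + 2)) = -L := by
    rw [one_div, Real.log_inv]
  -- the three `negMulLog` terms
  have e0 : (1 / ((q : ℝ) + 2) + q * δ) * (L - q * (q + 2) * δ) ≤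
      negMulLog (1 / ((q : ℝ) + 2) + q * δ) := by
    have := mul_le_mul_of_nonneg_left hlog0 (le_of_lt hm0)
    show _ ≤ -(1 / ((q : ℝ) + 2) + q * δ) * Real.log (1 / ((q : ℝ) + 2) + q * δ)
    linarith
  have ei : (1 / ((q : ℝ) + 2) - δ) * (L + (q + 2) * δ) ≤
      negMulLog (1 / ((q : ℝ) + 2) - δ) := by
    have := mul_le_mul_of_nonneg_left hlogi hmi
    show _ ≤ -(1 / ((q : ℝ) + 2) - δ) * Real.log (1 / ((q : ℝ) + 2) - δ)
    linarith
  have e2 : negMulLog (1 / ((q : ℝ) + 2)) = L / ((q : ℝ) + 2) := by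
    show -(1 / ((q : ℝ) + 2)) * Real.log (1 / ((q : ℝ) + 2)) = _
    rw [hlog2]
    ring
  have eqi := mul_le_mul_of_nonneg_left ei hq0
  -- exact bookkeeping: Σ masses = 1 carries `L`, the first-order terms leave `−q(q+1)(q+2)δ²`
  have hid : L - q * (q + 1) * (q + 2) * δ ^ 2 =
      (1 / ((q : ℝ) + 2) + q * δ) * (L - q * (q + 2) * δ)
        + q * ((1 / ((q : ℝ) + 2) - δ) * (L + (q + 2) * δ)) + L / ((q : ℝ) + 2) := by
    field_simp
    ring
  linarith [hid, e0, eqi, e2]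

/-- z-marginal of `P_δ`: uniform on `q+2` symbols, entropy exactly `log(q+2)`. [folklore] -/
theorem hz_eq (q : ℕ) :
    ((q : ℝ) + 2) * negMulLog (1 / ((q : ℝ) + 2)) = Real.log ((q : ℝ) + 2) := by
  have hq2 : (q : ℝ) + 2 ≠ 0 := by positivity
  show ((q : ℝ) + 2) * (-(1 / ((q : ℝ) + 2)) * Real.log (1 / ((q : ℝ) + 2))) = _
  rw [one_div, Real.log_inv]
  field_simp

/-! ## Part B — the three vertex inequalities at `δ = 1/((q+2)(1+r))` -/

/-- Vertex `θ = (1,0,0)`: for `q ≥ 2`, `t ≤ 1` and `(q+2)³ ≤ 1+r`, the x-marginal entropy of `P_δ`,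
`δ = 1/((q+2)(1+r))`, is at least `(1+t)/(1+r) · log(q+2)`
(indeed `qδ log(1/δ) = q (log(q+2) + log(1+r))/((q+2)(1+r)) ≥ 4q log(q+2)/((q+2)(1+r)) ≥ 2 log(q+2)/(1+r)`).
[cite: ChristandlLeGallLysikovZuiddam2025, Lemma 4.1 and Thm. 3.15] -/
theorem thinFloor_x (q : ℕ) (hq : 2 ≤ q) {t r : ℝ} (ht1 : t ≤ 1)
    (hr : ((q : ℝ) + 2) ^ 3 ≤ 1 + r) :
    (1 + t) / (1 + r) * Real.log ((q : ℝ) + 2) ≤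
      negMulLog (1 - q * (1 / (((q : ℝ) + 2) * (1 + r))))
        + q * negMulLog (1 / (((q : ℝ) + 2) * (1 + r))) := by
  set L := Real.log ((q : ℝ) + 2) with hL
  set δ := 1 / (((q : ℝ) + 2) * (1 + r)) with hδ
  have hqR : (2 : ℝ) ≤ q := by exact_mod_cast hq
  have hq2 : (4 : ℝ) ≤ (q : ℝ) + 2 := by linarith
  have hq2pos : (0 : ℝ) < (q : ℝ) + 2 := by linarith
  have h64 : (64 : ℝ) ≤ ((q : ℝ) + 2) ^ 3 := by
    have h16 : (16 : ℝ) ≤ ((q : ℝ) + 2) ^ 2 := by nlinarith [hq2]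
    nlinarith [h16, hq2]
  have h1r : (64 : ℝ) ≤ 1 + r := le_trans h64 hr
  have hr0 : (0 : ℝ) < 1 + r := by linarith
  have hL1 : 1 ≤ L := by
    rw [hL]
    have : Real.log (Real.exp 1) ≤ Real.log ((q : ℝ) + 2) :=
      Real.log_le_log (Real.exp_pos 1) (by
        have := Real.exp_one_lt_d9
        linarith)
    rwa [Real.log_exp] at this
  have hL0 : 0 ≤ L := by linarith
  have hlogr : 3 * L ≤ Real.log (1 + r) := by
    have := Real.log_le_log (by positivity) hr
    rwa [Real.log_pow, Nat.cast_ofNat] at this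
  have hδ0 : 0 < δ := by positivity
  have hδ1 : δ * (((q : ℝ) + 2) * (1 + r)) = 1 := by
    rw [hδ]
    field_simp
  have hqδ : (q : ℝ) * δ ≤ 1 := by
    -- qδ = q/((q+2)(1+r)) ≤ 1
    rw [hδ, mul_one_div, div_le_one (by positivity)]
    nlinarith
  have key := hx_lower q (le_of_lt hδ0) hqδ
  have hlogδ : Real.log (1 / δ) = L + Real.log (1 + r) := by
    rw [hδ, one_div_one_div, Real.log_mul (ne_of_gt hq2pos) (ne_of_gt hr0)]
  rw [hlogδ] at key
  -- (1+t)/(1+r) · L ≤ qδ (L + log(1+r)):  multiply by (q+2)(1+r) > 0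
  have step : (1 + t) / (1 + r) * L ≤ (q : ℝ) * δ * (L + Real.log (1 + r)) := by
    rw [div_mul_eq_mul_div, div_le_iff₀ hr0]
    -- (1+t) L ≤ qδ(L + log(1+r))(1+r) = q (L + log(1+r)) / (q+2)
    have e : (q : ℝ) * δ * (L + Real.log (1 + r)) * (1 + r) =
        q * (L + Real.log (1 + r)) / ((q : ℝ) + 2) := by
      rw [hδ]
      field_simp
    rw [e, le_div_iff₀ hq2pos]
    have s1 : (1 + t) * L * ((q : ℝ) + 2) ≤ 2 * L * ((q : ℝ) + 2) := by
      have := mul_le_mul_of_nonneg_right (show 1 + t ≤ 2 by linarith)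
        (show 0 ≤ L * ((q : ℝ) + 2) by positivity)
      nlinarith
    have s2 : 2 * L * ((q : ℝ) + 2) ≤ 4 * L * q := by nlinarith
    have s3 : (q : ℝ) * (3 * L) ≤ q * Real.log (1 + r) :=
      mul_le_mul_of_nonneg_left hlogr (by positivity)
    nlinarith
  linarith

/-- Vertex `θ = (0,1,0)`: for `q + 2 ≤ (1−t)(1+r) log(q+2)` (and `(q+2)³ ≤ 1+r`), the y-marginal entropy
of `P_δ`, `δ = 1/((q+2)(1+r))`, is at least `(t+r)/(1+r) · log(q+2) = log(q+2) − (1−t) log(q+2)/(1+r)`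
(the loss `q(q+1)(q+2)δ² = q(q+1)/((q+2)(1+r)²)` is below `(1−t) log(q+2)/(1+r)`).
[cite: ChristandlLeGallLysikovZuiddam2025, Lemma 4.1 and Thm. 3.15] -/
theorem thinFloor_y (q : ℕ) (hq : 2 ≤ q) {t r : ℝ}
    (hr : ((q : ℝ) + 2) ^ 3 ≤ 1 + r)
    (hlin : (q : ℝ) + 2 ≤ (1 - t) * (1 + r) * Real.log ((q : ℝ) + 2)) :
    (t + r) / (1 + r) * Real.log ((q : ℝ) + 2) ≤
      negMulLog (1 / ((q : ℝ) + 2) + q * (1 / (((q : ℝ) + 2) * (1 + r))))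
        + q * negMulLog (1 / ((q : ℝ) + 2) - 1 / (((q : ℝ) + 2) * (1 + r)))
        + negMulLog (1 / ((q : ℝ) + 2)) := by
  set L := Real.log ((q : ℝ) + 2) with hL
  set δ := 1 / (((q : ℝ) + 2) * (1 + r)) with hδ
  have hqR : (2 : ℝ) ≤ q := by exact_mod_cast hq
  have hq2 : (4 : ℝ) ≤ (q : ℝ) + 2 := by linarith
  have hq2pos : (0 : ℝ) < (q : ℝ) + 2 := by linarith
  have h64 : (64 : ℝ) ≤ ((q : ℝ) + 2) ^ 3 := by
    have h16 : (16 : ℝ) ≤ ((q : ℝ) + 2) ^ 2 := by nlinarith [hq2]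
    nlinarith [h16, hq2]
  have hr0 : (0 : ℝ) < 1 + r := by linarith
  have hδ0 : 0 < δ := by positivity
  have hδ1 : δ * (((q : ℝ) + 2) * (1 + r)) = 1 := by
    rw [hδ]
    field_simp
  have hδ' : ((q : ℝ) + 2) * δ < 1 := by
    -- (q+2)δ = 1/(1+r) < 1
    have : ((q : ℝ) + 2) * δ = 1 / (1 + r) := by
      rw [hδ]
      field_simp
    rw [this, div_lt_one hr0]
    linarith
  have key := hy_lower q (le_of_lt hδ0) hδ'
  -- loss bound: q(q+1)(q+2) δ² ≤ (1−t) L/(1+r)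
  have loss : (q : ℝ) * (q + 1) * (q + 2) * δ ^ 2 ≤ (1 - t) * L / (1 + r) := by
    rw [le_div_iff₀ hr0]
    -- q(q+1)(q+2)δ²(1+r) = q(q+1) δ/(1) · [(q+2)δ(1+r)] = q(q+1) δ ... use δ(q+2)(1+r) = 1
    have e : (q : ℝ) * (q + 1) * (q + 2) * δ ^ 2 * (1 + r) = q * (q + 1) * δ := by
      have : δ ^ 2 * (((q : ℝ) + 2) * (1 + r)) = δ := by
        rw [pow_two, mul_assoc, hδ1, mul_one]
      calc (q : ℝ) * (q + 1) * (q + 2) * δ ^ 2 * (1 + r)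
          = q * (q + 1) * (δ ^ 2 * (((q : ℝ) + 2) * (1 + r))) := by ring
        _ = q * (q + 1) * δ := by rw [this]
    rw [e]
    -- q(q+1)δ ≤ (1−t)L  ⟸  q(q+1) ≤ (q+2)² and (q+2)²δ ≤ (1−t)L(q+2)δ·(1+r)… : from hlin·δ(q+2)
    have h1 : (q : ℝ) * (q + 1) * δ ≤ ((q : ℝ) + 2) ^ 2 * δ :=
      mul_le_mul_of_nonneg_right (by nlinarith) (le_of_lt hδ0)
    have h2 : ((q : ℝ) + 2) ^ 2 * δ ≤ (1 - t) * L := by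
      -- multiply hlin by (q+2)δ ≥ 0 and use (1+r)(q+2)δ = 1
      have := mul_le_mul_of_nonneg_right hlin (show 0 ≤ ((q : ℝ) + 2) * δ by positivity)
      have e2 : (1 - t) * (1 + r) * L * (((q : ℝ) + 2) * δ) = (1 - t) * L := by
        calc (1 - t) * (1 + r) * L * (((q : ℝ) + 2) * δ)
            = (1 - t) * L * (δ * (((q : ℝ) + 2) * (1 + r))) := by ring
          _ = (1 - t) * L := by rw [hδ1, mul_one]
      calc ((q : ℝ) + 2) ^ 2 * δ = ((q : ℝ) + 2) * (((q : ℝ) + 2) * δ) := by ring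
        _ ≤ (1 - t) * (1 + r) * L * (((q : ℝ) + 2) * δ) := this
        _ = (1 - t) * L := e2
    linarith
  have split : (t + r) / (1 + r) * L = L - (1 - t) * L / (1 + r) := by
    field_simp
    ring
  rw [split]
  linarith [key, loss]

/-- Vertex `θ = (0,0,1)`: the z-marginal of `P_δ` is uniform, entropy `log(q+2) ≥ 1 · log(q+2)`.
[folklore] -/
theorem thinFloor_z (q : ℕ) :
    Real.log ((q : ℝ) + 2) ≤ ((q : ℝ) + 2) * negMulLog (1 / ((q : ℝ) + 2)) :=
  le_of_eq (hz_eq q).symm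

/-! ## Part C — all `θ` at once: no quantum / support functional excludes the certificate -/

/-- **Thin-axis barrier consistency.** For `q ≥ 2`, `t ≤ 1`, `(q+2)³ ≤ 1+r` and
`q+2 ≤ (1−t)(1+r) log(q+2)`, and every `θ = (θ₁,θ₂,θ₃) ≥ 0`, the `θ`-weighted marginal entropy of the
law `P_δ` on `supp(CW_q)` is at least `(θ₁(1+t)/(1+r) + θ₂(t+r)/(1+r) + θ₃) · log(q+2)`; for
`θ₁+θ₂+θ₃ = 1` the coefficient is `1 − [θ₁(r−t)+θ₂(1−t)]/(1+r)`, i.e. inequality `(E)` of the module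
docstring: the quantum functional `F^θ(CW_q) = ζ^θ(CW_q)` (free tensor) is large enough that
`F^θ(CW_q)^N ≥ K·F^θ(⟨M,M^t,M^r⟩)` is consistent with `K M^{1+r} = (q+2)^N`.
[cite: ChristandlVranaZuiddam2023, Thm. 4.20] [cite: ChristandlLeGallLysikovZuiddam2025, Thm. 3.15 and Lemma 4.1] -/
theorem thinFloor_allTheta (q : ℕ) (hq : 2 ≤ q) {t r : ℝ} (ht1 : t ≤ 1)
    (hr : ((q : ℝ) + 2) ^ 3 ≤ 1 + r)
    (hlin : (q : ℝ) + 2 ≤ (1 - t) * (1 + r) * Real.log ((q : ℝ) + 2))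
    {θ₁ θ₂ θ₃ : ℝ} (h₁ : 0 ≤ θ₁) (h₂ : 0 ≤ θ₂) (h₃ : 0 ≤ θ₃) :
    (θ₁ * ((1 + t) / (1 + r)) + θ₂ * ((t + r) / (1 + r)) + θ₃) * Real.log ((q : ℝ) + 2) ≤
      θ₁ * (negMulLog (1 - q * (1 / (((q : ℝ) + 2) * (1 + r))))
              + q * negMulLog (1 / (((q : ℝ) + 2) * (1 + r))))
      + θ₂ * (negMulLog (1 / ((q : ℝ) + 2) + q * (1 / (((q : ℝ) + 2) * (1 + r))))
              + q * negMulLog (1 / ((q : ℝ) + 2) - 1 / (((q : ℝ) + 2) * (1 + r)))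
              + negMulLog (1 / ((q : ℝ) + 2)))
      + θ₃ * (((q : ℝ) + 2) * negMulLog (1 / ((q : ℝ) + 2))) := by
  have hx := mul_le_mul_of_nonneg_left (thinFloor_x q hq ht1 hr) h₁
  have hy := mul_le_mul_of_nonneg_left (thinFloor_y q hq hr hlin) h₂
  have hz := mul_le_mul_of_nonneg_left (thinFloor_z q) h₃
  nlinarith [hx, hy, hz]

/-- The coefficient of `thinFloor_allTheta` on the simplex:
`θ₁(1+t)/(1+r) + θ₂(t+r)/(1+r) + θ₃ = 1 − [θ₁(r−t) + θ₂(1−t)]/(1+r)` when `θ₁+θ₂+θ₃ = 1`, `r ≠ −1`.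
[folklore] -/
theorem coeff_simplex {t r θ₁ θ₂ θ₃ : ℝ} (hr : 1 + r ≠ 0) (hθ : θ₁ + θ₂ + θ₃ = 1) :
    θ₁ * ((1 + t) / (1 + r)) + θ₂ * ((t + r) / (1 + r)) + θ₃ =
      1 - (θ₁ * (r - t) + θ₂ * (1 - t)) / (1 + r) := by
  have h3 : θ₃ = 1 - θ₁ - θ₂ := by linarith
  subst h3
  field_simp
  ring

/-- **Barrier value ≤ 1 + r (CLLZ eq. (5) form on the thin axis).** Under the hypotheses of
`thinFloor_allTheta`, for every `θ ≥ 0` (homogeneous in `θ`; on the simplex this is the barrier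
statement): the exponent `E_θ(1,t,r) = θ₁(1+t) + θ₂(t+r) + θ₃(1+r)` of
`F^θ(⟨M,M^t,M^r⟩) = M^{E_θ}` satisfies `E_θ · log(q+2) ≤ (1+r) · Σ_j θ_j H(P_δ,j)`, i.e. the universal-method
lower bound `E_θ · log R̃(CW_q) / log F^θ(CW_q)` on the certifiable exponent of shape `(1,t,r)` does not
exceed the information value `1 + r` — for EVERY `θ`: no known adequate functional bars the exact thin
certificate. [cite: ChristandlLeGallLysikovZuiddam2025, Thm. 3.15 and eq. (5)] [cite: ChristandlVranaZuiddam2023, Thm. 4.20] -/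
theorem thinFloor_barrier_le (q : ℕ) (hq : 2 ≤ q) {t r : ℝ} (ht1 : t ≤ 1)
    (hr : ((q : ℝ) + 2) ^ 3 ≤ 1 + r)
    (hlin : (q : ℝ) + 2 ≤ (1 - t) * (1 + r) * Real.log ((q : ℝ) + 2))
    {θ₁ θ₂ θ₃ : ℝ} (h₁ : 0 ≤ θ₁) (h₂ : 0 ≤ θ₂) (h₃ : 0 ≤ θ₃) :
    (θ₁ * (1 + t) + θ₂ * (t + r) + θ₃ * (1 + r)) * Real.log ((q : ℝ) + 2) ≤
      (1 + r) *
        (θ₁ * (negMulLog (1 - q * (1 / (((q : ℝ) + 2) * (1 + r))))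
                + q * negMulLog (1 / (((q : ℝ) + 2) * (1 + r))))
        + θ₂ * (negMulLog (1 / ((q : ℝ) + 2) + q * (1 / (((q : ℝ) + 2) * (1 + r))))
                + q * negMulLog (1 / ((q : ℝ) + 2) - 1 / (((q : ℝ) + 2) * (1 + r)))
                + negMulLog (1 / ((q : ℝ) + 2)))
        + θ₃ * (((q : ℝ) + 2) * negMulLog (1 / ((q : ℝ) + 2)))) := by
  have hqR : (2 : ℝ) ≤ q := by exact_mod_cast hq
  have hq2 : (4 : ℝ) ≤ (q : ℝ) + 2 := by linarith
  have h64 : (64 : ℝ) ≤ ((q : ℝ) + 2) ^ 3 := by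
    have h16 : (16 : ℝ) ≤ ((q : ℝ) + 2) ^ 2 := by nlinarith [hq2]
    nlinarith [h16, hq2]
  have hr0 : (0 : ℝ) < 1 + r := by linarith
  have main := thinFloor_allTheta q hq ht1 hr hlin h₁ h₂ h₃
  have := mul_le_mul_of_nonneg_left main (le_of_lt hr0)
  have e : (1 + r) * ((θ₁ * ((1 + t) / (1 + r)) + θ₂ * ((t + r) / (1 + r)) + θ₃) *
      Real.log ((q : ℝ) + 2)) =
      (θ₁ * (1 + t) + θ₂ * (t + r) + θ₃ * (1 + r)) * Real.log ((q : ℝ) + 2) := by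
    field_simp
  linarith [this, e]

/-! ## Part D — the explicit linear floor in the ladder's currency -/

/-- **Linear floor.** For `q ≥ 2` and `0 ≤ t < 1` put
`R_q(t) := max((q+2)³, (q+2)/((1−t) log(q+2)))`; every `r` with `1 + r ≥ R_q(t)` satisfies both
hypotheses of `thinFloor_barrier_le`.  Hence along the thin axis the universal-method floor grows at most
LINEARLY in `1/(1−t)` for a fixed tensor `CW_q` — against the ladder's proved reach
`r ≤ C·θ^{1/(1−t)}` only for `θ ≥ θ_F = 2^{47/30}` (`SaturationLadderFamilyConstant.base_of_ge_family`):
`SubexpSaturation`, `PolySaturation` and `Base θ` for every `θ > 1` are not barrier-excluded.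
[cite: ChristandlLeGallLysikovZuiddam2025, Thm. 3.15] -/
theorem thinFloor_hypotheses_of_ge_max (q : ℕ) (hq : 2 ≤ q) {t r : ℝ} (ht : t < 1)
    (hR : max (((q : ℝ) + 2) ^ 3) (((q : ℝ) + 2) / ((1 - t) * Real.log ((q : ℝ) + 2))) ≤ 1 + r) :
    ((q : ℝ) + 2) ^ 3 ≤ 1 + r ∧ (q : ℝ) + 2 ≤ (1 - t) * (1 + r) * Real.log ((q : ℝ) + 2) := by
  have hqR : (2 : ℝ) ≤ q := by exact_mod_cast hq
  have hL : 0 < Real.log ((q : ℝ) + 2) := Real.log_pos (by linarith)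
  have h1t : 0 < 1 - t := by linarith
  refine ⟨le_trans (le_max_left _ _) hR, ?_⟩
  have h2 := le_trans (le_max_right _ _) hR
  rw [div_le_iff₀ (mul_pos h1t hL)] at h2
  linarith [h2]

end Summit.MatrixMultiplication.MatrixMultiplication.Theorems.SaturationLadderThinFloor

end
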